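import Summits.CriticalPhenomena.SAWScalingLimit.Theorems.SAWTotalPositivityCriticalBubbleBoundKestenCutWalks

/-!
# Line `kesten-product-renewal-dictionary` (crux stmt-CriticalPhenomena-7117): the two-bridge cut, III —
the cut map and its injectivity

Proof file (lead seat c1). The CUT MAP sends `ω ∈ Zd.sawFun 2 n e₀` (`n ≥ 2`) to the pair of bridges
`(W₁, W₂)` of the lexicographic two-bridge cut of its rooted polygon (`fstWalk`, `sndWalk`) together with the
POSITION `rootPos n ω ≤ n` of the root edge `{e₀, 0}` on the polygon walked from its lowest vertex. Main
results: `eq_of_cut_eq` (reconstruction of `ω` from `W₁`, `W₂`, `ℓ` and the root position — via the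
translation-free `shape` of the polygon) and the packaged statement `cut_injection` consumed by the
summation step of the line (`…KestenCutSum.lean`: `c_n(0,e₀) x_c^n ≤ μ² Σ_{pairs} (|W₁|+|W₂|) x_c^{|W₁|+|W₂|}`,
whence `G_{x_c}(0,e₀) ≤ x_c + μ² Σ_h M₂(h)` — stub A / `TwoBridgeBound` of the line card).
-/

noncomputable section

open Literature.Probability.LatticeModels
open Literature.Probability.RandomPlanarGeometry Literature.Probability.RandomPlanarGeometry.SAW
open scoped BigOperators
open Summit.CriticalPhenomena.SAWScalingLimit.Theorems.CriticalBubbleBound.Negative (e₀ adj_zero_e₀)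

namespace Summit.CriticalPhenomena.SAWScalingLimit.Theorems.CriticalBubbleBound.Kesten.Cut

variable {n : ℕ} {ω : ℕ → Site 2}

/-! ## The polygon walked from its lowest vertex -/

/-- The polygon is its shape translated by `T`: `vtx j = shape j + T` for `j ≤ n + 1`. [folklore] -/
theorem vtx_eq_shape {j : ℕ} (hj : j ≤ n + 1) :
    vtx n ω j = shape (fstWalk n ω) (sndWalk n ω) (arcLen n ω) n j + shiftVec n ω := by
  have hℓ := arcLen_le (n := n) (ω := ω)
  have hsum := arcLen_add_coLen (n := n) (ω := ω)
  unfold shape vtx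
  split_ifs with h1 h2
  · rw [fstWalk_of_pos (by omega) (by omega), Nat.add_sub_cancel, sub_add_cancel]
  · rw [sndWalk_of_pos (by omega) (by omega), sub_add_cancel, sub_add_cancel,
      pos_not (s := dir n ω) (by omega)]
  · -- `j = n + 1`: back at `B`
    have hj' : j = n + 1 := by omega
    rw [fstWalk_of_pos le_rfl (by omega), Nat.sub_self, sub_add_cancel, cyc_pos_zero, hj']
    cases dir n ω
    · simp [pos, off, cyc_baseIdx]
    · simp [pos, off, cyc_add_period, cyc_baseIdx]

/-! ## The root position -/

/-- `m ≤ n`. [folklore] -/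
theorem rootPos_le : rootPos n ω ≤ n := by
  have := baseIdx_le (n := n) (ω := ω)
  unfold rootPos; split_ifs <;> omega

/-- In direction `true` the root edge is traversed westwards: positions `m`, `m+1` carry `e₀`, `0`.
[folklore] -/
theorem vtx_rootPos_true (hω : ω ∈ Zd.sawFun 2 n e₀) (hd : dir n ω = true) :
    vtx n ω (rootPos n ω) = e₀ ∧ vtx n ω (rootPos n ω + 1) = 0 := by
  have hb := baseIdx_le (n := n) (ω := ω)
  simp only [vtx, rootPos, hd, ↓reduceIte, pos, off_true]
  rw [show baseIdx n ω + (n - baseIdx n ω) = n by omega,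
    show baseIdx n ω + (n - baseIdx n ω + 1) = 0 + (n + 1) by omega, cyc_add_period,
    cyc_of_le le_rfl, cyc_of_le (Nat.zero_le n), apply_of_le hω le_rfl, apply_zero hω]
  exact ⟨rfl, rfl⟩

/-- In direction `false` the root edge is traversed eastwards: positions `m`, `m+1` carry `0`, `e₀`.
[folklore] -/
theorem vtx_rootPos_false (hω : ω ∈ Zd.sawFun 2 n e₀) (hd : dir n ω = false) :
    vtx n ω (rootPos n ω) = 0 ∧ vtx n ω (rootPos n ω + 1) = e₀ := by
  have hb := baseIdx_le (n := n) (ω := ω)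
  simp only [vtx, rootPos, hd, Bool.false_eq_true, ↓reduceIte, pos, off_false]
  rw [show baseIdx n ω + (n + 1 - baseIdx n ω) = 0 + (n + 1) by omega, cyc_add_period,
    show baseIdx n ω + (n + 1 - (baseIdx n ω + 1)) = n by omega,
    cyc_of_le le_rfl, cyc_of_le (Nat.zero_le n), apply_of_le hω le_rfl, apply_zero hω]
  exact ⟨rfl, rfl⟩

/-- The direction is read off the shape at the root position: the step there is `-e₀` iff `dir = true`.
[folklore] -/
theorem dir_eq_true_iff (hω : ω ∈ Zd.sawFun 2 n e₀) :
    dir n ω = true ↔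
      shape (fstWalk n ω) (sndWalk n ω) (arcLen n ω) n (rootPos n ω + 1) -
        shape (fstWalk n ω) (sndWalk n ω) (arcLen n ω) n (rootPos n ω) = -e₀ := by
  have hm := rootPos_le (n := n) (ω := ω)
  have key : shape (fstWalk n ω) (sndWalk n ω) (arcLen n ω) n (rootPos n ω + 1) -
      shape (fstWalk n ω) (sndWalk n ω) (arcLen n ω) n (rootPos n ω) =
      vtx n ω (rootPos n ω + 1) - vtx n ω (rootPos n ω) := by
    rw [vtx_eq_shape (n := n) (ω := ω) (j := rootPos n ω + 1) (by omega),
      vtx_eq_shape (n := n) (ω := ω) (j := rootPos n ω) (by omega)]; abel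
  rw [key]
  constructor
  · intro hd
    rw [(vtx_rootPos_true hω hd).1, (vtx_rootPos_true hω hd).2, zero_sub]
  · intro h
    by_contra hd
    rw [Bool.not_eq_true] at hd
    rw [(vtx_rootPos_false hω hd).1, (vtx_rootPos_false hω hd).2, sub_zero] at h
    have := congrFun h 0
    simp [e₀] at this

/-- The translation is read off at the root position, too. [folklore] -/
theorem shiftVec_eq (hω : ω ∈ Zd.sawFun 2 n e₀) :
    shiftVec n ω = (if dir n ω then e₀ else 0) -
      shape (fstWalk n ω) (sndWalk n ω) (arcLen n ω) n (rootPos n ω) := by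
  have hm := rootPos_le (n := n) (ω := ω)
  have h := vtx_eq_shape (n := n) (ω := ω) (j := rootPos n ω) (by omega)
  cases hd : dir n ω
  · rw [(vtx_rootPos_false hω hd).1] at h
    simp only [Bool.false_eq_true, ↓reduceIte]
    rw [h]; abel
  · rw [(vtx_rootPos_true hω hd).1] at h
    simp only [↓reduceIte]
    rw [h]; abel

/-- The base index is read off the root position and the direction. [folklore] -/
theorem baseIdx_eq : baseIdx n ω = if dir n ω then n - rootPos n ω else rootPos n ω := by
  have := baseIdx_le (n := n) (ω := ω)
  unfold rootPos; split_ifs <;> omega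

/-- Every index `i ≤ n` is some chain position `j ≤ n`. [folklore] -/
theorem exists_pos_eq (hω : ω ∈ Zd.sawFun 2 n e₀) {i : ℕ} (hi : i ≤ n) :
    ∃ j ≤ n, ω i = vtx n ω j := by
  have hb := baseIdx_le (n := n) (ω := ω)
  cases hd : dir n ω
  · refine ⟨(baseIdx n ω + (n + 1) - i) % (n + 1), Nat.lt_succ_iff.1 (Nat.mod_lt _ (Nat.succ_pos n)), ?_⟩
    rw [vtx, hd, ← cyc_of_le (ω := ω) hi, cyc_eq_iff hω, pos, off_false]
    -- `i ≡ b + (n+1) - ((b + (n+1) - i) % (n+1))`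
    set t := (baseIdx n ω + (n + 1) - i) % (n + 1) with ht
    have htlt : t < n + 1 := Nat.mod_lt _ (Nat.succ_pos n)
    have h₁ : t ≡ baseIdx n ω + (n + 1) - i [MOD n + 1] := Nat.mod_modEq _ _
    show i ≡ baseIdx n ω + (n + 1 - t) [MOD n + 1]
    refine Nat.ModEq.add_right_cancel h₁.symm ?_
    rw [show baseIdx n ω + (n + 1 - t) + t = baseIdx n ω + (n + 1) by omega,
      show i + (baseIdx n ω + (n + 1) - i) = baseIdx n ω + (n + 1) by omega]
  · refine ⟨(i + (n + 1) - baseIdx n ω) % (n + 1), Nat.lt_succ_iff.1 (Nat.mod_lt _ (Nat.succ_pos n)), ?_⟩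
    rw [vtx, hd, ← cyc_of_le (ω := ω) hi, cyc_eq_iff hω, pos, off_true, Nat.add_mod, Nat.mod_mod,
      ← Nat.add_mod, show baseIdx n ω + (i + (n + 1) - baseIdx n ω) = i + (n + 1) by omega,
      Nat.add_mod_right]

/-! ## The cut map -/

/-- The zero-step bridge (used as a default value off the domain of the cut map). [folklore] -/
theorem zero_mem_bridges : (fun _ : ℕ => (0 : Site 2)) ∈ Zd.bridges 2 0 := by
  refine Zd.mem_bridges.2 ⟨Zd.mem_saws.2 ⟨rfl, fun _ _ => rfl, fun i hi => absurd hi (Nat.not_lt_zero i),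
    fun i hi j hj _ => ?_⟩, fun i h1 h2 => absurd (h1.trans h2) (by norm_num)⟩
  simp only [Set.mem_setOf_eq, Nat.le_zero] at hi hj
  rw [hi, hj]

/-- Reconstruction: two walks of `Zd.sawFun 2 n e₀` with the same `W₁`, `W₂`, `ℓ` and root position are
equal (the shape gives the polygon up to translation; the step of the shape at the root position gives
the direction of travel, then the translation and the base index, hence every vertex). [folklore] -/
theorem eq_of_cut_eq {ω ω' : ℕ → Site 2} (hω : ω ∈ Zd.sawFun 2 n e₀)
    (hω' : ω' ∈ Zd.sawFun 2 n e₀) (hW₁ : fstWalk n ω = fstWalk n ω') (hW₂ : sndWalk n ω = sndWalk n ω')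
    (hℓ : arcLen n ω = arcLen n ω') (hm : rootPos n ω = rootPos n ω') : ω = ω' := by
  have hshape : shape (fstWalk n ω) (sndWalk n ω) (arcLen n ω) n =
      shape (fstWalk n ω') (sndWalk n ω') (arcLen n ω') n := by rw [hW₁, hW₂, hℓ]
  have hdir : dir n ω = dir n ω' := by
    rw [Bool.eq_iff_iff, dir_eq_true_iff hω, dir_eq_true_iff hω', hshape, hm]
  have hT : shiftVec n ω = shiftVec n ω' := by
    rw [shiftVec_eq hω, shiftVec_eq hω', hdir, hshape, hm]
  have hb : baseIdx n ω = baseIdx n ω' := by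
    rw [baseIdx_eq, baseIdx_eq (ω := ω'), hdir, hm]
  have hvtx : ∀ j ≤ n + 1, vtx n ω j = vtx n ω' j := fun j hj => by
    rw [vtx_eq_shape hj, vtx_eq_shape hj, hshape, hT]
  have hpos : ∀ j, pos n ω (dir n ω) j = pos n ω' (dir n ω') j := fun j => by
    rw [pos, pos, hb, hdir]
  funext i
  rcases le_or_gt i n with hi | hi
  · obtain ⟨j, hj, hij⟩ := exists_pos_eq hω hi
    have hres : (pos n ω (dir n ω) j) % (n + 1) = i := by
      have := hij
      rw [vtx, ← cyc_of_le (ω := ω) hi, eq_comm, cyc_eq_iff hω] at this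
      rw [this, Nat.mod_eq_of_lt (Nat.lt_succ_of_le hi)]
    rw [hij, hvtx j (by omega)]
    show cyc n ω' (pos n ω' (dir n ω') j) = ω' i
    rw [← hpos, cyc, hres]
  · rw [apply_of_le hω hi.le, apply_of_le hω' hi.le]

open Classical in
/-- **The lexicographic two-bridge cut** (stub A of the line, combinatorial half): for `n ≥ 2` there is a map
from the `n`-step self-avoiding walks `0 → e₀` of `ℤ²` to pairs of bridges with a marked position —
`ω ↦ ((W₁, W₂), rootPos)` — injective on `Zd.sawFun 2 n e₀`, with values in the apex-meeting (`ApexMeet`),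
apex-only-touching (`OnlyApex`) pairs of total length `|W₁| + |W₂| = n + 2` and positions `< n + 2`.
Consequently `c_n(0,e₀) ≤ (n+2) · #{such pairs of total length n + 2}`. [folklore] -/
theorem cut_injection : ∀ n : ℕ, 2 ≤ n → ∃ Ψ : (ℕ → Site 2) → BridgePair × ℕ, Set.InjOn Ψ ↑(Zd.sawFun 2 n e₀) ∧ ∀ ω ∈ Zd.sawFun 2 n e₀, ApexMeet (Ψ ω).1 ∧ OnlyApex (Ψ ω).1 ∧ (Ψ ω).1.1.len + (Ψ ω).1.2.len = n + 2 ∧ (Ψ ω).2 < n + 2 := by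
  intro n hn
  -- the cut map, with the zero-step bridges as a default value off the domain
  let Ψ : (ℕ → Site 2) → BridgePair × ℕ := fun ω =>
    if h : ω ∈ Zd.sawFun 2 n e₀ then
      ((⟨arcLen n ω + 1, ⟨fstWalk n ω, fstWalk_mem_bridges h hn⟩⟩,
        ⟨coLen n ω, ⟨sndWalk n ω, sndWalk_mem_bridges h hn⟩⟩), rootPos n ω)
    else ((⟨0, ⟨fun _ => 0, zero_mem_bridges⟩⟩, ⟨0, ⟨fun _ => 0, zero_mem_bridges⟩⟩), 0)
  have hΨ : ∀ {ω : ℕ → Site 2} (h : ω ∈ Zd.sawFun 2 n e₀), Ψ ω =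
      ((⟨arcLen n ω + 1, ⟨fstWalk n ω, fstWalk_mem_bridges h hn⟩⟩,
        ⟨coLen n ω, ⟨sndWalk n ω, sndWalk_mem_bridges h hn⟩⟩), rootPos n ω) := fun h => dif_pos h
  refine ⟨Ψ, ?_, ?_⟩
  · intro ω hω ω' hω' h
    rw [Finset.mem_coe] at hω hω'
    rw [hΨ hω, hΨ hω'] at h
    exact eq_of_cut_eq hω hω' (congrArg (fun q : BridgePair × ℕ => q.1.1.fn) h)
      (congrArg (fun q : BridgePair × ℕ => q.1.2.fn) h)
      (Nat.succ_injective (congrArg (fun q : BridgePair × ℕ => q.1.1.len) h))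
      (congrArg (fun q : BridgePair × ℕ => q.2) h)
  · intro ω hω
    rw [hΨ hω]
    refine ⟨?_, ?_, ?_, ?_⟩
    · show fstWalk n ω (arcLen n ω + 1) = sndWalk n ω (coLen n ω) + eUp
      rw [fstWalk_len hω, sndWalk_len hω, sub_add_cancel]
    · intro i hi j hj h
      exact fst_eq_snd_add_iff hω hn hi hj h
    · show arcLen n ω + 1 + coLen n ω = n + 2
      have := arcLen_add_coLen (n := n) (ω := ω); omega
    · show rootPos n ω < n + 2
      have := rootPos_le (n := n) (ω := ω); omega

end Summit.CriticalPhenomena.SAWScalingLimit.Theorems.CriticalBubbleBound.Kesten.Cut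

end
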